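import Literature.Barriers.HodgeConjecture.GeneralizedHodgeTrivialReasonsEllipticCurveCubedModel
import Literature.AlgebraicGeometry.HodgeTheory.SupportedClassesSemipurity
import Literature.NumberTheory.Transcendental.DeRhamTheoremProofs
import HarnessLib

/-!
# Grothendieck (1969), pp. 299–300 — the periods of `E_τ³` DISCHARGED, the odd rank on `E_τ³`
# from the inclusion (∗) alone, and the range `i < 2p` of the even-rank fact outright

Theorems-only leaf of the Grothendieck-1969 cluster (`GeneralizedHodgeTrivialReasons*.lean`; no
definition, no named fact — D-0026), collecting what two recent theorems of the tree give at once: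

* de Rham's theorem with complex coefficients, `exists_complexDeRhamIsoFamily_holds`
  (`Transcendental/DeRhamTheoremProofs`: integration over smooth simplices, complexified), and
* the semipurity of the coniveau filtration, `supportedClasses_eq_bot_of_lt`
  (`HodgeTheory/SupportedClassesSemipurity`: `Nᵖ Hⁱ(X(ℂ); ℂ) = 0` for `i < 2p`, Voisin I
  Lemma 11.13 along the filtration of Thm. 11.11).

Results:

* `Grothendieck1969_ellipticCurveCubed_hodgeDecomposition_holds` — **DISCHARGE of the named fact
  `Grothendieck1969_ellipticCurveCubed_hodgeDecomposition`** (`…FiltOne`: the Hodge structure of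
  `H³(E_τ³)` in the Künneth basis, Lange–Birkenhake §1.1, from which Grothendieck's "immediately
  computed" rank `2ⁱ - N` of `Filt¹Hⁱ` is proved there): its reduction
  `Grothendieck1969_ellipticCurveCubed_hodgeDecomposition_of_deRham` (`…EllipticCurveCubedModel`:
  `E_τ³ = cubeScheme τ _` is an algebraic model of the torus `ℂ³/(ℤ + τℤ)³`) fed
  `exists_complexDeRhamIsoFamily_holds (Fin 3 → ℂ)`.
* `Grothendieck1969_ellipticCurveCubed_oddRank_of_le_hodgeFiltration` — hence the named fact
  `Grothendieck1969_ellipticCurveCubed_oddRank` (odd rank `17` of the rational classes of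
  `F¹H³(E_τ³)`, `τ` cubic, and `N¹H³ ∩ H³(–, ℚ) ⊆ F¹`) follows from Grothendieck's "well-known"
  inclusion (∗) `Filt'ᵖ ⊂ Filtᵖ` (`Grothendieck1969_supportedClasses_le_hodgeFiltration`) ALONE.
* `Grothendieck1969_rationalSupportedClasses_evenRank_of_lt` — **the range `i < 2p` of the named
  fact `Grothendieck1969_rationalSupportedClasses_evenRank`, unconditionally**: there
  `Nᵖ Hⁱ(X(ℂ); ℂ) = 0`, whose rational classes `{0}` have the empty `ℚ`-basis
  (`isRatBasisOn_of_forall_eq_zero`). (The case `p = 0` — odd Betti numbers are even — is proved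
  in the sibling `…OfDeligne` from the Hodge decomposition; what is left to Deligne's theorem is
  the range `1 ≤ p ≤ i/2`, `i` odd, Grothendieck's `i = 3`, `p = 1` being the first case.)

## References

* [GrothendieckTopology1969] A. Grothendieck, *Hodge's general conjecture is false for trivial
  reasons*, Topology 8 (1969) 299–303, §1 and pp. 299–300.
* [LangeBirkenhake1992] H. Lange, Ch. Birkenhake, *Complex Abelian Varieties* (1992), §1.1.3–§1.1.5.
* [VoisinHodgeI2002] C. Voisin, *Hodge Theory and Complex Algebraic Geometry I* (2002), §11.1.2
  Lemma 11.13, §11.1.1 Thm. 11.11.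
* [WellsDACM1980] R. O. Wells, *Differential Analysis on Complex Manifolds* (1980), Thm. III.4.13.
-/

noncomputable section

open CategoryTheory

namespace Literature.Barriers.HodgeConjecture

section Barriers
section HodgeConjecture

open Literature.AlgebraicGeometry.HodgeTheory Literature.AlgebraicGeometry.Motives
  Literature.AlgebraicTopology.SingularHomology
open Literature.NumberTheory.Transcendental (exists_complexDeRhamIsoFamily_holds)

/-! ### The periods of `E_τ³`, discharged -/

/-- **Discharge of the named fact `Grothendieck1969_ellipticCurveCubed_hodgeDecomposition`**
(`…FiltOne`): for every `τ` with `Im τ > 0` there is a smooth projective complex threefold — the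
cube `E_τ³` of the Weierstrass cubic of `ℤ + τℤ` (`cubeScheme`, `…EllipticCurveCubedModel`) — with
a Hodge model whose `H³` has the Künneth `ℚ`-basis of `H³((ℂ/(ℤ + τℤ))³)` and the Hodge pieces
`H^{3,0} = ℂ dv₀dv₁dv₂`, `H^{2,1}`, `H^{1,2}`, `H^{0,3}` of the complex torus (Lange–Birkenhake,
§1.1.3 Lemma 1.1.17, §1.1.5 Thm. 1.1.21 and Prop. 1.1.23). Everything was reduced in the tree to
de Rham's theorem with complex coefficients on manifolds charted on `ℂ³`
(`Grothendieck1969_ellipticCurveCubed_hodgeDecomposition_of_deRham`), which is now the theorem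
`exists_complexDeRhamIsoFamily_holds` (the integration family over smooth singular simplices,
complexified). [cite: LangeBirkenhake1992, §1.1.3 Lemma 1.1.17, §1.1.5 Thm. 1.1.21 and Prop. 1.1.23]
[cite: SilvermanAEC2009, VI Prop. 3.6] [cite: WellsDACM1980, Thm. III.4.13]
[cite: GrothendieckTopology1969, p. 300] -/
theorem Grothendieck1969_ellipticCurveCubed_hodgeDecomposition_holds :
    Grothendieck1969_ellipticCurveCubed_hodgeDecomposition :=
  Grothendieck1969_ellipticCurveCubed_hodgeDecomposition_of_deRham
    (exists_complexDeRhamIsoFamily_holds (Fin 3 → ℂ))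

/-- **`Grothendieck1969_ellipticCurveCubed_oddRank` from the inclusion (∗) alone**: with the
periods of `E_τ³` discharged, the odd rank (`17`) of the rational classes of `F¹H³(E_τ³)`, `τ`
cubic, together with `N¹H³ ∩ H³(–, ℚ) ⊆ F¹`, follows from Grothendieck's "well-known" inclusion
(∗) `Filt'ᵖ Hⁱ(X^an, ℚ) ⊂ Filtᵖ Hⁱ(X^an, ℂ)` (the named fact
`Grothendieck1969_supportedClasses_le_hodgeFiltration`, clause (ii) of Voisin 2014 Thm. 2.39)
through `Grothendieck1969_ellipticCurveCubed_oddRank_of_hodgeDecomposition` (`…FiltOne`: `τ = ∛2`,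
`rank = 20 - N = 17`). [cite: GrothendieckTopology1969, pp. 299–300] [cite: VoisinChowRings2014, Thm. 2.39] -/
theorem Grothendieck1969_ellipticCurveCubed_oddRank_of_le_hodgeFiltration
    (hstar : Grothendieck1969_supportedClasses_le_hodgeFiltration) :
    Grothendieck1969_ellipticCurveCubed_oddRank :=
  Grothendieck1969_ellipticCurveCubed_oddRank_of_hodgeDecomposition
    Grothendieck1969_ellipticCurveCubed_hodgeDecomposition_holds hstar

/-! ### The range `i < 2p` of the even-rank fact, outright: semipurity `Nᵖ Hⁱ = 0` -/

/-- A subset consisting of `0` alone has the empty family as a `ℚ`-basis. [folklore] -/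
theorem isRatBasisOn_of_forall_eq_zero {H : Type*} [AddCommGroup H] [Module ℂ H] {S : Set H}
    (h0 : (0 : H) ∈ S) (hS : ∀ c ∈ S, c = 0) (b : Fin 0 → H) : IsRatBasisOn S b := by
  have hcomb : ∀ q : Fin 0 → ℚ, ratComb b q = 0 := fun q ↦ by simp [ratComb]
  exact ⟨fun q ↦ (hcomb q).symm ▸ h0, fun c hc ↦
    ⟨0, (hcomb 0).trans (hS c hc).symm, fun q _ ↦ Subsingleton.elim _ _⟩⟩

/-- **The range `i < 2p` of `Grothendieck1969_rationalSupportedClasses_evenRank`, unconditionally**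
(in particular every odd `i < 2p`): by the semipurity of the coniveau filtration,
`Nᵖ Hⁱ(X(ℂ); ℂ) = 0` for `i < 2p` (`supportedClasses_eq_bot_of_lt`,
`HodgeTheory/SupportedClassesSemipurity`: Voisin I Lemma 11.13 along the filtration of Thm. 11.11,
PROVED there), so its rational classes are `{0}`, with the empty `ℚ`-basis (`2 · 0` elements).
[cite: GrothendieckTopology1969, §1 and p. 300] [cite: VoisinHodgeI2002, §11.1.2 Lemma 11.13] -/
theorem Grothendieck1969_rationalSupportedClasses_evenRank_of_lt {n : ℕ} {X : SchemeOver ℂ}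
    (hX : IsSmoothProjective n X) {i p : ℕ} (hip : i < 2 * p) :
    ∃ (m : ℕ) (b : Fin (2 * m) → complexBetti X i),
      IsRatBasisOn {c : complexBetti X i | IsRationalClass c ∧ c ∈ supportedClasses X i p} b := by
  refine ⟨0, fun j ↦ Fin.elim0 j, isRatBasisOn_of_forall_eq_zero ?_ (fun c hc ↦ ?_) _⟩
  · exact ⟨IsRationalClass.zero, Submodule.zero_mem _⟩
  · simpa [supportedClasses_eq_bot_of_lt hX hip] using hc.2

end HodgeConjecture
end Barriers

end Literature.Barriers.HodgeConjecture

end
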